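import Summits.HodgeConjecture.HodgeConjecture.Theses.HeckePrymWeil
import Summits.HodgeConjecture.HodgeConjecture.Theorems.HeckePrymWeilWeilTwelvefoldsSqrtMinus7HodgeModelFacts
import Summits.HodgeConjecture.HodgeConjecture.Theorems.HeckePrymWeilWeilSixfoldsSqrtMinus7HodgeTypeExterior
import Summits.HodgeConjecture.HodgeConjecture.Theorems.HeckePrymWeilWeilSixfoldsSqrtMinus7Descent
import Literature.AlgebraicGeometry.Motives.AbelianVarietyProduct
import Literature.AlgebraicGeometry.Motives.AbelianVarietyProductDimProofs
import Literature.AlgebraicGeometry.Motives.HyperbolicWeilType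
import Literature.AlgebraicGeometry.Motives.AimedSplitProduct
import Literature.AlgebraicGeometry.HodgeTheory.WeilClassesFourfoldsProofs
import Literature.AlgebraicGeometry.HodgeTheory.HodgeModelExistence
import Literature.NumberTheory.Transcendental.DeRhamTheorem
import HarnessLib

/-!
# Crux `WeilSixfoldsSqrtMinus7` (stmt-HodgeConjecture-1260), line `hyperbolic-eightfold-descent` — the composition: `HyperbolicEightfoldsSqrtMinus7 → WeilSixfoldsSqrtMinus7`, conditional on two named facts

Route `HeckePrymWeil`. The crux: on every complex abelian SIXFOLD `A` with `φ ≫ φ = -7` every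
rational `(3,3)`-class in the Weil span `Eig((𝟙+φ)^*, (1+i√7)⁶) ⊔ Eig((𝟙+φ)^*, (1-i√7)⁶)` is
algebraic — ALL discriminants `det H ∈ ℚ^×/Nm(ℚ(√-7)^×)` (open mathematics off `det H = -1`:
Markman arXiv:2502.03415 Thm 1.5.1 covers the split component only; arXiv:2603.20268 §1).

This file PROVES the line's reduction on the tree's real carriers:

  `weilSixfoldsSqrtMinus7_of_hyperbolicEightfolds :`
  `  exists_cmWeilSurface_aimedSplitProduct → (∀ E, exists_deRhamIsoFamily 𝓘(ℝ, E)) →`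
  `  HyperbolicEightfoldsSqrtMinus7 → WeilSixfoldsSqrtMinus7`,

i.e. the glue item `EightfoldDescentGlue` (stmt-14751) with its lever `AimedDescending` discharged
at `(p, n) = (7, 3)` GRANTED exactly two Literature NAMED FACTS (D-0014) — the theorem is
CONDITIONAL on these and on nothing else:

1. `Literature.AlgebraicGeometry.Motives.exists_cmWeilSurface_aimedSplitProduct`
   (`Literature/AlgebraicGeometry/Motives/AimedSplitProduct`, proposed p91901 by this line): the AIMING LEMMA of Schoen's / Markman's product trick
   in the route's polarised typing — a CM Weil surface `B = E × E` with a descent pair such that for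
   every Weil-type `(A, φ)` the product `A × B`, suitably embedded, is of SPLIT (hyperbolic) Weil type
   for the `K`-symmetrised hyperplane class (Markman arXiv:2509.23403 §11.5 Step 2, printed for
   fourfolds; van Geemen LNM 1594 Lemma 5.2 (3), 5.3, 5.4; Schoen Compositio 114 §10). Not provable
   in the tree today: no positive-dimensional `AbelianVariety ℂ` term (CM elliptic curve as a group
   scheme), no `dim H¹(A(ℂ)) = 2 dim A`, no Riemann form on `H₁(A(ℂ), ℚ)` — see the Disproof files
   of cruxes 1260 (§3) and 14642 (§3(a)).
2. `Literature.NumberTheory.Transcendental.exists_deRhamIsoFamily` (de Rham's theorem as a natural,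
   MULTIPLICATIVE, normalised family; Warner Thm 5.36/5.45): consumed by the Künneth-for-Hodge-types
   step (the cup product respects Hodge types). Conjunct (a) of that step, `nonempty_hodgeModel`, is
   the theorem `AmnesicSecantSheaves.nonempty_hodgeModel_all_holds` and is fed here.

Everything else is a THEOREM of the tree: the Künneth-for-Hodge-types step
`HyperbolicEightfoldDescent.stub_hodgeTypeExterior` (this line, wave 1), Schoen's descent `8 → 6`
for one partner surface `HyperbolicEightfoldDescent.stub_descent` (this line, wave 1: rational Weil
projector, real Gysin `complexGysin` with Poincaré duality, projection formula, Gysin base change,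
moving divisors by translations — all unconditional), `dim (A × B) = 8`, `(φ × ψ)² = -7`.

Proof: given `(A, φ)` and a rational `(3,3)` Weil class `c`; `c = 0` is algebraic; otherwise `c`
witnesses Weil type, fact 1 at `d = 7`, `n = 3` yields `B`, `ψ`, the descent pair `(b₊, b₋, η)` and
`(e, a)` with `(A × B, φ × ψ, 7·e.ι^*a + (φ×ψ)^*e.ι^*a)` hyperbolic; `HyperbolicEightfoldsSqrtMinus7`
makes every rational `(4,4)` Weil class of `(A × B, φ × ψ)` algebraic; the descent returns `c`.

What this does NOT do: it does not touch `HyperbolicEightfoldsSqrtMinus7` (item 14642, the deciding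
open case: Markman's Question 8.2.4 at `d = 7`), so it closes nothing; it records that the sixfold
crux for ALL discriminants is, in Lean and on the real carriers, the split EIGHTFOLD crux plus two
named facts.
-/

noncomputable section

-- single-problem summit (Problem = Summit): the mandated namespace repeats `HodgeConjecture`.
set_option linter.dupNamespace false

open CategoryTheory
open Literature.AlgebraicGeometry Literature.AlgebraicGeometry.Motives
  Literature.AlgebraicGeometry.HodgeTheory Literature.AlgebraicTopology.SingularHomology

namespace Summit.HodgeConjecture.HodgeConjecture.Theorems.WeilSixfoldsSqrtMinus7.HyperbolicEightfoldDescent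

/-- **The line `hyperbolic-eightfold-descent`: split ℚ(√-7)-Weil EIGHTFOLDS give the ℚ(√-7)-Weil
SIXFOLD crux for ALL discriminants**, granted the aiming lemma
`exists_cmWeilSurface_aimedSplitProduct` and de Rham's theorem `exists_deRhamIsoFamily` (both named
facts; everything else proved). Given a sixfold `(A, φ)` and a rational `(3,3)` Weil class `c`: if
`c = 0` it is algebraic; otherwise `c` witnesses Weil type, the aiming lemma at `d = 7`, `n = 3`
yields the CM Weil surface `(B, ψ)`, its descent pair and a projective embedding `e` of `A × B` with a
rational `a ≠ 0` making `(A × B, φ × ψ)` hyperbolic for the `K`-symmetrised hyperplane class;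
`A × B` has dimension `8` and `(φ × ψ)² = -7`, so `HyperbolicEightfoldsSqrtMinus7` makes the rational
`(4,4)` Weil classes of `(A × B, φ × ψ)` algebraic, and Schoen's descent `stub_descent` — fed the
Künneth-for-Hodge-types theorem `stub_hodgeTypeExterior`, itself fed `nonempty_hodgeModel_all_holds`
and the de Rham fact — returns `c` algebraic (Schoen 1998 §10; Markman arXiv:2509.23403 §11.5
Step 2; Koike 2004). -/
theorem weilSixfoldsSqrtMinus7_of_hyperbolicEightfolds :
    Literature.AlgebraicGeometry.Motives.exists_cmWeilSurface_aimedSplitProduct →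
    (∀ (E : Type) [NormedAddCommGroup E] [NormedSpace ℂ E] [FiniteDimensional ℂ E],
      Literature.NumberTheory.Transcendental.exists_deRhamIsoFamily (modelWithCornersSelf ℝ E)) →
    Summit.HodgeConjecture.HodgeConjecture.Theses.HeckePrymWeil.HyperbolicEightfoldsSqrtMinus7 →
    Summit.HodgeConjecture.HodgeConjecture.Theses.HeckePrymWeil.WeilSixfoldsSqrtMinus7 := by
  intro hF hdR h8 A φ hA hφ c hrat hH hW
  by_cases hc : c = 0
  · rw [hc]
    exact Submodule.zero_mem _
  obtain ⟨B, ψ, hB, hψ, hpair, haim⟩ := hF 7 (by norm_num)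
  obtain ⟨e, a, har, ha0, hhyp⟩ := haim 3 A φ hA hφ ⟨c, hc, hrat, hH, hW⟩
  have hdim : (A.prod B).dim = 8 := by rw [AbelianVariety.dim_prod, hA, hB]
  have hφ' : φ ≫ φ = -((7 : ℕ) • 𝟙 A) := by rw [hφ, ← natCast_zsmul]; rfl
  have hψ' : ψ ≫ ψ = -((7 : ℕ) • 𝟙 B) := by rw [hψ, ← natCast_zsmul]
  have hsq : AbelianVariety.prodLift (AbelianVariety.fst A B ≫ φ) (AbelianVariety.snd A B ≫ ψ) ≫
      AbelianVariety.prodLift (AbelianVariety.fst A B ≫ φ) (AbelianVariety.snd A B ≫ ψ) =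
        -((7 : ℤ) • 𝟙 (A.prod B)) := by
    rw [prodLift_comp_self_eq_neg_nsmul hφ' hψ', ← natCast_zsmul]; rfl
  have hK := stub_hodgeTypeExterior
    (fun m Y => Summit.HodgeConjecture.HodgeConjecture.Theorems.WeilTwelvefoldsSqrtMinus7.AmnesicSecantSheaves.nonempty_hodgeModel_all_holds m Y)
    hdR
  exact stub_descent hK A φ B ψ hA hB hφ hψ hpair
    (h8 (A.prod B) _ hdim hsq e a har ha0 hhyp) c hrat hH hW

/-- **Equivalent packaging through the route's glue item**: granted the two named facts, the
deciding crux `HyperbolicEightfoldsSqrtMinus7` ALONE implies the sixfold crux — the lever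
`AimedDescending` of `EightfoldDescentGlue : HyperbolicEightfoldsSqrtMinus7 → AimedDescending →
WeilSixfoldsSqrtMinus7` (stmt-14751) is not needed as a hypothesis at `(p, n) = (7, 3)`. -/
theorem eightfoldDescentGlue_of_facts :
    Literature.AlgebraicGeometry.Motives.exists_cmWeilSurface_aimedSplitProduct →
    (∀ (E : Type) [NormedAddCommGroup E] [NormedSpace ℂ E] [FiniteDimensional ℂ E],
      Literature.NumberTheory.Transcendental.exists_deRhamIsoFamily (modelWithCornersSelf ℝ E)) →
    Summit.HodgeConjecture.HodgeConjecture.Theses.HeckePrymWeil.EightfoldDescentGlue :=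
  fun hF hdR h8 _ => weilSixfoldsSqrtMinus7_of_hyperbolicEightfolds hF hdR h8

end Summit.HodgeConjecture.HodgeConjecture.Theorems.WeilSixfoldsSqrtMinus7.HyperbolicEightfoldDescent
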